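import Summits.BirchSwinnertonDyer.BirchSwinnertonDyer.Theorems.KimAtThreeDeepLowerOffStratumLevelLoweringDepleteTamagawaRows
import Summits.BirchSwinnertonDyer.BirchSwinnertonDyer.Theorems.KimAtThreeDeepLowerOffStratumLevelLoweringMultiStabDepleteRowsClass
import HarnessLib

/-!
# Route `KimAtThreeKolyvagin` (rung W2), crux `DeepLowerAtThreeOffKatoStratum` (item 19679), registered
# stub `stub_nonAdditive`: the CLASS «(ram), ordinary-if-good, `v₃(∏ c_ℓ) = 1` with the Tamagawa `3` AT AN ADDITIVE
# place» — the (A) rows — WITHOUT row data, and the UNION with ★¹⁰: every depth-`1` (ram) row with `3 ∣ ∏ c_ℓ`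

Cell `bsd-addord`, seat `bsd-addord-w2-acc2`, gen 8; item `stmt-BirchSwinnertonDyer-19679` (`--supports`, closes
nothing). ROAD (b^k,add,A) file 3 = the class twin of ★¹² (`…DepleteTamagawaRows`): the additive Tamagawa-`3` prime
`ℓ` (`ℓ² ∣ N`, `3 ∣ c_ℓ`, hence Kodaira type `IV`/`IV*` and `ℓ` in the dropping set), the dropping set `A = A'·ℓ`
(`…MultiStabDepleteRowsClass.exists_dropSet`), the unramified multiplicative set `D` and the optimal level
`M₁ = N/(D·A)` (`exists_decomposition_exactlyDividing`) are CONSTRUCTED from the curve, the newform is the named fact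
`ribet1990_levelLowering_gamma0_newform_at_three_additiveDrop`, and ★¹² is applied. Class conditions beyond ★¹⁰'s
shape: «`3 ∣ c_ℓ` at some `ℓ² ∣ N`» replaces «`3 ∤ c_p` at every `p² ∣ N`», the guard «`p³ ∤ N` at every additive
place with `3 ∣ #Φ_p(𝔽̄_p)`» (`f_p = 2`) is kept, and Diamond–Ribet's size condition `N > 3ℓ²` (`N_Σ = N/ℓ > 3ℓ`)
is added. §2 is the UNION ★¹⁴ = ★¹⁰ ∨ ★¹³: binders + ordinary-if-good + `Ram W₀ 3` + `v₃(∏c) ≤ 1` + `3 ∣ ∏c` + the two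
decidable guards ⟹ the LOWER deep inequality, from TWELVE named facts — i.e. `stub_nonAdditive` on every depth-`1`
(ram) row up to the guards (census of gen 7: 35 690 (M) + 17 647 (A) non-semistable rows, and all semistable ones).
Theorems only; nothing booked; BSD is not proved by any of this.

* §1 ★¹³ᵃ `isStabilisedLevelLoweringCongruenceIn_of_additiveTamagawa` (the (LL₁) certificate at `ℓ` from class data, SIX
  facts) and ★¹³ `stub_nonAdditive_ram_tamagawaDepthOne_of_additiveTamagawa` (the (ram) consumer applied to it).
* §2 ★¹⁴ `stub_nonAdditive_ram_tamagawaDepthOne` (= ★¹⁰ ∨ ★¹³) and ★¹⁵ `stub_nonAdditive_ram_tamagawaDepthLeOne` (adds the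
  rows with `3 ∤ ∏ c_ℓ`, where the lower half of BSD₃ alone suffices: EVERY (ram) row of Tamagawa depth `≤ 1`, guards
  as in ★¹⁴). The covered («(ram) only if `3` is multiplicative») twin of ★¹³ is in `…DepleteTamagawaRowsCovered`.
[cite: DarmonDiamondTaylor1995, Thm. 3.15, Lemma 2.7, Thm. 3.1 (e)] [cite: DiamondRibet1997, §4.5 Lemma 4.6]
[cite: SilvermanATAEC1994, Cor. IV.9.2, Table 4.1, §IV.10, Prop. 10.3] [cite: Skinner2016PacificMC, Thm. C (§1)]
[cite: Vatsal1999, §1 (1.6), Thm. (1.13)] [cite: Ribet1984ICM, Thm. 4.1] [cite: ColemanEdixhoven1998, Thm. 2.1]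
-/

set_option autoImplicit false
-- the Theorems namespace of a single-conjunct summit repeats the summit name by design (D-0017)
set_option linter.dupNamespace false

noncomputable section

open scoped MatrixGroups ModularForm Classical NNReal NumberField

open CongruenceSubgroup WeierstrassCurve Literature.NumberTheory.EllipticCurves
  Literature.NumberTheory.EllipticCurves.ModularForms IsDedekindDomain NumberField Rat.HeightOneSpectrum

namespace Summit.BirchSwinnertonDyer.BirchSwinnertonDyer.Theorems.KimAtThreeDeepLowerOffStratumLevelLoweringDepleteTamagawaRowsClass

open Summit.BirchSwinnertonDyer.BirchSwinnertonDyer.Theorems.KimAtThreeDeepLowerOffStratumLevelLoweringMultiStabDepleteRows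
open Summit.BirchSwinnertonDyer.BirchSwinnertonDyer.Theorems.KimAtThreeDeepLowerOffStratumLevelLoweringMultiStabDepleteRowsClass
open Summit.BirchSwinnertonDyer.BirchSwinnertonDyer.Theorems.KimAtThreeDeepLowerOffStratumLevelLoweringDepleteTamagawaRows
open Summit.BirchSwinnertonDyer.BirchSwinnertonDyer.Theorems.KimAtThreeDeepLowerOffStratumLevelLoweringMultiStabRowsRamClass
  (exists_decomposition_exactlyDividing three_dvd_componentGroupOrder_of_three_dvd_localTamagawaNumber_padic)
open Summit.BirchSwinnertonDyer.BirchSwinnertonDyer.Theorems.KimAtThreeDeepLowerOffStratumLevelLoweringMultiStabRowsRam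
  (stub_nonAdditive_ram_of_isStabilisedLevelLoweringCongruenceIn)
open Summit.BirchSwinnertonDyer.BirchSwinnertonDyer.Theorems.KimAtThreeShallowEqDeepOffStratumNonAdditiveRows
  (not_sq_dvd_conductorNorm_of_not_addv periodTransfer_three_of_optimal_of_not_addv)
open Summit.BirchSwinnertonDyer.BirchSwinnertonDyer.Theorems.KimAtThreeDeepLowerSmallDefect
  (deepLower_conclusion_of_missingLowerBoundAt_of_not_dvd_tamagawa)
open Summit.BirchSwinnertonDyer.BirchSwinnertonDyer.Theorems.KimAtThreeDeepLowerNonAdditiveRows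
  (analyticRank_eq_zero_of_kuriharaVanishingOrder_eq_zero)
open Summit.BirchSwinnertonDyer.BirchSwinnertonDyer.Theorems.KimAtThreeDeepLowerOffStratumSockets
  (missingLowerBoundAt_three_of_rowC1_of_skinner)
open Literature.NumberTheory.EllipticCurves.Rank1Residual Literature.NumberTheory.EllipticCurves.Rank1Residual.Typed
  Literature.NumberTheory.EllipticCurves.Skinner2016 Literature.NumberTheory.Automorphic
open IsDedekindDomain Rat.HeightOneSpectrum

/-! ### §1 ★¹³ The class theorem for the (A) rows: the Tamagawa `3` at an additive place -/

section ClassA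

/-- ★¹³ᵃ **THE (LL₁) CERTIFICATE AT THE ADDITIVE TAMAGAWA-`3` PRIME, FROM CLASS DATA.** For a tower-surjective `W₀`
off the additive stratum at `3`, a datum `D₀` at the conductor with `3`-integral plus symbols, a prime `ℓ` with
`ℓ² ∣ N` and `3 ∣ c_ℓ` (so the place over `ℓ` is additive of Kodaira type `IV`/`IV*`), `N > 3ℓ²`, and `p³ ∤ N` at every
additive place with `3 ∣ #Φ_p(𝔽̄_p)`: `IsStabilisedLevelLoweringCongruenceIn W₀ 3 1 D₀.f ℓ π` for some `π`. The dropping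
set `A = A'·ℓ` (`exists_dropSet`), the unramified multiplicative set `D` and the optimal level `M₁ = N/(D·A)`
(`exists_decomposition_exactlyDividing`, `P r := 3 ∣ ord_r Δ ∧ r² ∤ N`) are CONSTRUCTED from the curve, the newform is
the named fact `ribet1990_levelLowering_gamma0_newform_at_three_additiveDrop`, and ★¹²ᵃ
(`…DepleteTamagawaRows.isStabilisedLevelLoweringCongruenceIn_of_exists_levelLoweredNewform_depleteAt`) is applied.
SIX named facts. [cite: DarmonDiamondTaylor1995, Thm. 3.15, Lemma 2.7, Thm. 3.1 (e)] [cite: DiamondRibet1997, §4.5 Lemma 4.6]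
[cite: Carayol1986, Thm. (A)] [cite: ColemanEdixhoven1998, Thm. 2.1] [cite: Vatsal1999, §1 (1.6), Thm. (1.13)]
[cite: GreenbergVatsal2000, §3 (17)–(19)] [cite: SilvermanATAEC1994, Cor. IV.9.2 (d), Table 4.1, §IV.10] -/
theorem isStabilisedLevelLoweringCongruenceIn_of_additiveTamagawa
    (hRk : ribet1990_levelLowering_gamma0_newform_at_three_additiveDrop)
    (hDR : diamondRibet1997_iharaLemma_at_dividingPrime_three_additive)
    (hCa : carayol1986_cuspCoeff_congr_at_additiveDrop_three)
    (hCE : colemanEdixhoven1998_heckePolynomial_simpleRoots)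
    (hV : vatsal1999_plusSymbol_congruence) (hGV : greenbergVatsal2000_plusSymbol_congruence) :
    ∀ (W₀ : WeierstrassCurve ℚ) [W₀.IsElliptic] [W₀.IsGloballyMinimal],
      (∀ n : ℕ, W₀.HasSurjectiveModNGaloisRep (3 ^ n : ℕ)) →
      ∀ {N : ℕ} [NeZero N], N = W₀.conductorNorm ℤ →
      ∀ (D₀ : ModularParametrizationData W₀ N),
        (∀ r : ℚ, ratPlusSymbol D₀.f r ≠ 0 → 0 ≤ padicValRat 3 (ratPlusSymbol D₀.f r)) →
        ¬ (haveI : Fact (Nat.Prime 3) := ⟨Nat.prime_three⟩; Addv W₀ 3) →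
        ∀ (ℓ : ℕ) (hℓ : ℓ.Prime), ℓ ^ 2 ∣ N → 3 ∣ (haveI := Fact.mk hℓ; (W₀.baseChange ℚ_[ℓ]).localTamagawaNumber ℤ_[ℓ]) →
        3 * ℓ ^ 2 < N →
        (∀ v : HeightOneSpectrum ℤ, W₀.HasAdditiveReductionAt v → 3 ∣ (W₀.kodairaSymbolAt v).componentGroupOrder →
          ¬ natGenerator v ^ 3 ∣ N) →
        ∃ π : ZMod 3 →+* IsLocalRing.ResidueField (Valued.integer (PadicAlgCl 3)),
          IsStabilisedLevelLoweringCongruenceIn W₀ 3 1 D₀.f ℓ π := by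
  intro W₀ _ _ htower N _ hN D₀ hint hnA ℓ hℓ hℓ2N h3c hbig hK3
  haveI : Fact ℓ.Prime := ⟨hℓ⟩
  have hsurj : W₀.HasSurjectiveModNGaloisRep 3 := by simpa using htower 1
  have h9 : ¬ 3 ^ 2 ∣ N := hN ▸ not_sq_dvd_conductorNorm_of_not_addv W₀ hnA
  have hf := D₀.isNewformOf
  -- the place `v` of `ℤ` over `ℓ`: additive, of Kodaira type `IV`/`IV*` (`3 ∣ c_ℓ ∣ #Φ_v`)
  set v : HeightOneSpectrum ℤ := (primesEquiv (R := ℤ)).symm ⟨ℓ, hℓ⟩ with hvdef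
  have hpv : primesEquiv v = ⟨ℓ, hℓ⟩ := (primesEquiv (R := ℤ)).apply_symm_apply ⟨ℓ, hℓ⟩
  have hgen : natGenerator v = ℓ := congrArg Subtype.val hpv
  have hadd : W₀.HasAdditiveReductionAt v := by
    rw [← natGenerator_sq_dvd_conductorNorm_iff v W₀, hgen, ← hN]; exact hℓ2N
  have h3Φ : 3 ∣ (W₀.kodairaSymbolAt v).componentGroupOrder :=
    three_dvd_componentGroupOrder_of_three_dvd_localTamagawaNumber_padic (W := W₀) ℓ h3c v hgen
  -- §1 of ★¹⁰: the dropping set `A`, `ℓ ∣ A`, `A ∣ N`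
  obtain ⟨A, hAsq, hAadd, hAiff, hAdvd⟩ := exists_dropSet W₀
  rw [← hN] at hAadd
  haveI : NeZero A := ⟨Squarefree.ne_zero hAsq⟩
  have hℓA : ℓ ∣ A := hgen ▸ (hAiff v hadd).mp h3Φ
  obtain ⟨A', hA'⟩ := hℓA
  have hℓA' : ¬ ℓ ∣ A' := fun h ↦ by
    have : ℓ * ℓ ∣ A := by rw [hA']; exact mul_dvd_mul_left ℓ h
    exact hℓ.ne_one (Nat.isUnit_iff.mp (hAsq ℓ this))
  have hA'sq : Squarefree A' := Squarefree.squarefree_of_dvd ⟨ℓ, by rw [hA', mul_comm]⟩ hAsq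
  obtain ⟨N₂, hN₂⟩ : A ∣ N := hAdvd N fun p hp hpA ↦ (dvd_pow_self p two_ne_zero).trans (hAadd p hp hpA)
  have hN₂0 : N₂ ≠ 0 := fun h ↦ NeZero.ne N (by rw [hN₂, h, mul_zero])
  -- every prime of `A` is squared in `N = A N₂` with `A` squarefree: it divides `N₂`
  have hAN₂ : ∀ p : ℕ, p.Prime → p ∣ A → p ∣ N₂ := by
    intro p hp hpA
    obtain ⟨A'', hA''⟩ := hpA
    have hpA'' : ¬ p ∣ A'' := fun h ↦ by
      have : p * p ∣ A := by rw [hA'']; exact mul_dvd_mul_left p h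
      exact hp.ne_one (Nat.isUnit_iff.mp (hAsq p this))
    have h2 : p * p ∣ p * (A'' * N₂) := by rw [← mul_assoc, ← hA'', ← hN₂, ← pow_two]; exact hAadd p hp ⟨A'', hA''⟩
    have h3 : p ∣ A'' * N₂ := Nat.dvd_of_mul_dvd_mul_left hp.pos h2
    exact ((Nat.Prime.coprime_iff_not_dvd hp).mpr hpA'').dvd_of_dvd_mul_left h3
  -- `N₂ = M₁·D`, `D` = the primes `r ∥ N` outside `A` with `3 ∣ ord_r Δ`
  obtain ⟨M₁, D, hMD, hDsq, hDM₁, hDP, hM₁P⟩ :=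
    exists_decomposition_exactlyDividing hN₂0 (fun r ↦ (3 : ℤ) ∣ padicValRat r W₀.Δ ∧ ¬ r ^ 2 ∣ N)
  haveI : NeZero M₁ := ⟨fun h ↦ hN₂0 (by rw [← hMD, h, zero_mul])⟩
  have hNeq : M₁ * D * A' * ℓ = N := by rw [hN₂, hA', ← hMD]; ring
  have hNeq' : M₁ * A * D = N := by rw [hN₂, ← hMD]; ring
  have hDexact : ∀ p : ℕ, p.Prime → p ∣ D → ¬ p ^ 2 ∣ N := fun p hp hpD ↦ ((hDP p hp hpD).1).2
  have hAD : Nat.Coprime A D := by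
    refine Nat.coprime_of_dvd fun p hp hpA hpD ↦ hDexact p hp hpD (hAadd p hp hpA)
  have hA'D : Nat.Coprime A' D := Nat.Coprime.coprime_dvd_left ⟨ℓ, by rw [hA', mul_comm]⟩ hAD
  have hℓD : ¬ ℓ ∣ D := fun h ↦ hℓ.ne_one (Nat.Coprime.eq_one_of_dvd (Nat.Coprime.coprime_dvd_left ⟨A', hA'⟩ hAD) h)
  have hℓDA' : ¬ ℓ ∣ D * A' := fun h ↦ by
    rcases (Nat.Prime.dvd_mul hℓ).mp h with h | h
    · exact hℓD h
    · exact hℓA' h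
  -- the primes of `A` divide `M₁` exactly once, and `a_p(f_E) = 0` there
  have hA : ∀ p : ℕ, p.Prime → p ∣ A → p ∣ M₁ ∧ ¬ p ^ 2 ∣ M₁ ∧ cuspCoeff D₀.f p = 0 := by
    intro p hp hpA
    haveI : Fact p.Prime := ⟨hp⟩
    set w : HeightOneSpectrum ℤ := (primesEquiv (R := ℤ)).symm ⟨p, hp⟩ with hwdef
    have hpw : primesEquiv w = ⟨p, hp⟩ := (primesEquiv (R := ℤ)).apply_symm_apply ⟨p, hp⟩
    have hgenw : natGenerator w = p := congrArg Subtype.val hpw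
    have hpN2 : p ^ 2 ∣ W₀.conductorNorm ℤ := hN ▸ hAadd p hp hpA
    have haddw : W₀.HasAdditiveReductionAt w := by
      rw [← natGenerator_sq_dvd_conductorNorm_iff w W₀, hgenw]; exact hpN2
    have h3Φw : 3 ∣ (W₀.kodairaSymbolAt w).componentGroupOrder := (hAiff w haddw).mpr (hgenw ▸ hpA)
    have hpD : ¬ p ∣ D := fun h ↦ hp.ne_one (Nat.dvd_one.mp (by
      have hg := Nat.dvd_gcd hpA h; rwa [Nat.Coprime.gcd_eq_one hAD] at hg))
    have hpM₁ : p ∣ M₁ :=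
      ((Nat.Prime.coprime_iff_not_dvd hp).mpr hpD).dvd_of_dvd_mul_right (by rw [hMD]; exact hAN₂ p hp hpA)
    have hp2 : ¬ p ^ 2 ∣ M₁ := by
      intro h
      refine hK3 w haddw h3Φw ?_
      rw [hgenw, ← hNeq', pow_succ]
      exact (mul_dvd_mul h hpA).trans ⟨D, by ring⟩
    refine ⟨hpM₁, hp2, ?_⟩
    have hng : ¬ W₀.HasGoodReductionAtPrime p := fun hg ↦
      not_dvd_conductorNorm_of_hasGoodReductionAtPrime W₀ hg ((dvd_pow_self p two_ne_zero).trans hpN2)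
    have hnm : ¬ W₀.HasMultiplicativeReductionAtPrime p := fun hm ↦ by
      have key : ∀ r : Nat.Primes, primesEquiv w = r →
          (haveI := Fact.mk r.2; W₀.HasMultiplicativeReductionAtPrime (r : ℕ)) → W₀.HasMultiplicativeReductionAt w := by
        rintro r rfl h'
        exact (hasMultiplicativeReductionAtPrime_primesEquiv_iff_hasMultiplicativeReductionAt W₀ w).mp h'
      exact (key ⟨p, hp⟩ hpw hm).not_hasAdditiveReductionAt haddw
    rw [hf.2 p, W₀.LFunction_apply_eq_zero_of_not_good_of_not_mult p hng hnm (dvd_refl p), Int.cast_zero]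
  obtain ⟨hℓM₁, hℓ2M₁, hfℓ⟩ := hA ℓ hℓ ⟨A', hA'⟩
  -- the signs `a_p(f) = ±1` at the (multiplicative) primes of `D`
  have hsign : ∀ p : ℕ, p.Prime → p ∣ D → ∃ u : ℤ, u * u = 1 ∧ cuspCoeff D₀.f p = u := by
    intro p hp hpD
    haveI : Fact p.Prime := ⟨hp⟩
    have hpN : p ∣ W₀.conductorNorm ℤ := by
      rw [← hN, ← hNeq']
      exact (hpD.mul_left (M₁ * A))
    have hp2 : ¬ p ^ 2 ∣ W₀.conductorNorm ℤ := hN ▸ hDexact p hp hpD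
    rcases hasGoodReductionAtPrime_or_hasMultiplicativeReductionAtPrime_of_not_sq_dvd_conductorNorm (V := W₀) hp2
      with hgood | hmult
    · exact absurd hpN (not_dvd_conductorNorm_of_hasGoodReductionAtPrime W₀ hgood)
    · by_cases hs : W₀.HasSplitMultiplicativeReductionAtPrime p
      · refine ⟨1, by norm_num, ?_⟩
        rw [hf.2 p, W₀.LFunction_apply_prime_of_hasSplitMultiplicativeReductionAtPrime p hs]
      · refine ⟨-1, by norm_num, ?_⟩
        rw [hf.2 p, W₀.LFunction_apply_prime_of_hasMultiplicativeReductionAtPrime_of_not_split p hmult hs]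
  -- the optimal-level newform from the additive-drop fact BY NAME (removed set `D`, dropping set `A`)
  have hcop : Nat.Coprime D (M₁ * A) := Nat.Coprime.mul_right hDM₁ hAD.symm
  have hDΔ : ∀ r : ℕ, r.Prime → r ∣ D → (3 : ℤ) ∣ padicValRat r W₀.Δ := fun r hr hrD ↦ (hDP r hr hrD).1.1
  have hM₁Δ' : ∀ p : ℕ, p.Prime → p ∣ M₁ → ¬ p ^ 2 ∣ N → ¬ (3 : ℤ) ∣ padicValRat p W₀.Δ := by
    intro p hp hpM hp2 h3
    refine hM₁P p hp hpM (fun hp2' ↦ hp2 ?_) ⟨h3, hp2⟩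
    rw [← hNeq', mul_assoc, mul_comm A D, ← mul_assoc, hMD]
    exact hp2'.mul_right A
  have hM₁Δ : ∀ p : ℕ, p.Prime → p ∣ M₁ → ¬ p ^ 2 ∣ N → p ≠ 3 → ¬ (3 : ℤ) ∣ padicValRat p W₀.Δ :=
    fun p hp hpM hp2 _ ↦ hM₁Δ' p hp hpM hp2
  have h3Δ : 3 ∣ M₁ → ¬ (3 : ℤ) ∣ padicValRat 3 W₀.Δ := fun h3M ↦ hM₁Δ' 3 Nat.prime_three h3M h9
  have hex : ∀ ι : PadicAlgCl 3 ≃+* ℂ, ∃ g : CuspForm (Gamma0 M₁) 2, IsNewform0 g ∧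
      (∀ p : ℕ, p.Prime → ¬ p ∣ D * A' * ℓ → Valued.v (ι.symm (cuspCoeff D₀.f p - cuspCoeff g p)) < 1) ∧
      (∀ p : ℕ, p.Prime → p ∣ D → Valued.v (ι.symm (cuspCoeff g p - cuspCoeff D₀.f p * (p + 1))) < 1) := by
    intro ι
    obtain ⟨g, hg, hcp, hrem⟩ := hRk W₀ hsurj (N := N) (M₁ := M₁) (A := A) (D := D) hNeq' hDsq hAsq hcop h9 hN hDΔ
      hM₁Δ h3Δ (fun p hp hpA ↦ hAadd p hp hpA) hAiff D₀ ι
    refine ⟨g, hg, fun p hp hpDAℓ ↦ hcp p hp fun h ↦ hpDAℓ ?_, hrem⟩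
    rw [mul_assoc, mul_comm A' ℓ, ← hA']; exact h
  have h3ℓ : 3 * ℓ < M₁ * D * A' := by
    have h := hbig
    rw [← hNeq, pow_two, ← mul_assoc] at h
    exact Nat.lt_of_mul_lt_mul_right h
  exact isStabilisedLevelLoweringCongruenceIn_of_exists_levelLoweredNewform_depleteAt hDR hCa hCE hV hGV W₀ htower hN D₀
    hint hnA v hNeq hgen hadd h3Φ h3c hℓM₁ hℓ2M₁ hℓDA' h3ℓ hfℓ hDsq hDM₁ hA'sq hA'D
    (fun p hp hpA' ↦ hA p hp (hpA'.trans ⟨ℓ, by rw [hA', mul_comm]⟩)) hsign hex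

/-- ★¹³ **`stub_nonAdditive` (crux 19679 `DeepLowerAtThreeOffKatoStratum`) on the CLASS of depth-`1` rows WITH (ram) whose
Tamagawa `3` sits AT AN ADDITIVE prime `ℓ` (`ℓ² ∣ N`, `3 ∣ c_ℓ`; Kodaira type `IV`/`IV*`), the additive places of type
`IV`/`IV*` having `f = 2`, and `N > 3ℓ²`, at ANY conductor — stub binders VERBATIM + «ordinary if good at `3`» +
`Ram W₀ 3` + `v₃(∏ c_ℓ) ≤ 1` — from ELEVEN NAMED FACTS and NOTHING ELSE**: ★¹³ᵃ's certificate fed to the (ram)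
consumer `…MultiStabRowsRam.stub_nonAdditive_ram_of_isStabilisedLevelLoweringCongruenceIn` at `q := ℓ ∣ N`.
[cite: DarmonDiamondTaylor1995, Thm. 3.15, Lemma 2.7, Thm. 3.1 (e)] [cite: DiamondRibet1997, §4.5 Lemma 4.6]
[cite: Skinner2016PacificMC, Thm. C (§1)] [cite: Mazur1978, Cor. 4.1] [cite: Kim2022StructureSelmer, Conj. 1.10 (PDF p. 8)]
[cite: SilvermanATAEC1994, Cor. IV.9.2 (d), Table 4.1, §IV.10] -/
theorem stub_nonAdditive_ram_tamagawaDepthOne_of_additiveTamagawa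
    (hRk : ribet1990_levelLowering_gamma0_newform_at_three_additiveDrop)
    (hDR : diamondRibet1997_iharaLemma_at_dividingPrime_three_additive)
    (hCa : carayol1986_cuspCoeff_congr_at_additiveDrop_three)
    (hCE : colemanEdixhoven1998_heckePolynomial_simpleRoots)
    (hV : vatsal1999_plusSymbol_congruence) (hGV : greenbergVatsal2000_plusSymbol_congruence)
    (hSk : Skinner2016.thmC_padicValRat_bsd_rank_zero)
    (hmod : hasEntireLFunction_rat) (hGZK : rank_eq_analyticRank_of_analyticRank_le_one)
    (hM : mazur_not_dvd_maninConstant_of_odd) :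
    ∀ (W₀ : WeierstrassCurve ℚ) [W₀.IsElliptic] [W₀.IsGloballyMinimal],
      (∀ n : ℕ, W₀.HasSurjectiveModNGaloisRep (3 ^ n : ℕ)) → Finite W₀.sha →
      ∀ {N : ℕ} [NeZero N], N = W₀.conductorNorm ℤ →
      ∀ (D₀ : ModularParametrizationData W₀ N),
        (∀ z ∈ D₀.L.lattice, ∃ w ∈ periodLattice D₀.f, z = D₀.c * w) →
        (∀ (W₂ : WeierstrassCurve ℚ) [W₂.IsElliptic] (D₂ : ModularParametrizationData W₂ N),
          D₂.f = D₀.f → D₀.modularDegree ≤ D₂.modularDegree) →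
        (∀ r : ℚ, ratPlusSymbol D₀.f r ≠ 0 → 0 ≤ padicValRat 3 (ratPlusSymbol D₀.f r)) →
        kuriharaVanishingOrder W₀ 3 D₀.f = 0 →
        ¬ (haveI : Fact (Nat.Prime 3) := ⟨Nat.prime_three⟩; Addv W₀ 3) →
        (W₀.HasGoodReductionAtPrime 3 → ¬ (3 : ℤ) ∣ W₀.frobeniusTrace 3) →
        (haveI : Fact (Nat.Prime 3) := ⟨Nat.prime_three⟩; Ram W₀ 3) →
        padicValNat 3 W₀.tamagawaProduct ≤ 1 →
        ∀ (ℓ : ℕ) (hℓ : ℓ.Prime), ℓ ^ 2 ∣ N → 3 ∣ (haveI := Fact.mk hℓ; (W₀.baseChange ℚ_[ℓ]).localTamagawaNumber ℤ_[ℓ]) →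
        3 * ℓ ^ 2 < N →
        (∀ v : HeightOneSpectrum ℤ, W₀.HasAdditiveReductionAt v → 3 ∣ (W₀.kodairaSymbolAt v).componentGroupOrder →
          ¬ natGenerator v ^ 3 ∣ N) →
        ∃ d : ℕ, kuriharaPartialDeepInfty W₀ 3 D₀.f = d ∧
          kuriharaPartial W₀ 3 D₀.f 0 ≤
            ((padicValNat 3 (Nat.card (AddCommGroup.primaryComponent W₀.sha 3)) + d : ℕ) : ℕ∞) := by
  intro W₀ _ _ htower hfin N _ hN D₀ hopt hdeg hint hord hnA hordinary hram hv ℓ hℓ hℓ2N h3c hbig hK3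
  obtain ⟨π, hLL⟩ := isStabilisedLevelLoweringCongruenceIn_of_additiveTamagawa hRk hDR hCa hCE hV hGV W₀ htower hN D₀ hint
    hnA ℓ hℓ hℓ2N h3c hbig hK3
  exact stub_nonAdditive_ram_of_isStabilisedLevelLoweringCongruenceIn hSk hmod hGZK hM W₀ htower hfin hN D₀ hopt hdeg
    hint hord hnA hordinary hram hv π ℓ (by rw [← hN]; exact (dvd_pow_self ℓ two_ne_zero).trans hℓ2N) hLL

end ClassA

/-! ### §2 ★¹⁴ Every depth-`1` row with (ram): the Tamagawa `3` anywhere -/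

section ClassAll

/-- ★¹⁴ **`stub_nonAdditive` (crux 19679) on the CLASS of ALL depth-`1` rows WITH (ram) and `3 ∣ ∏ c_ℓ`** — the Tamagawa
`3` at a multiplicative prime (★¹⁰ `…MultiStabDepleteRowsClass.stub_nonAdditive_ram_tamagawaDepthOne_of_drop`) OR at
an additive place (★¹³) — stub binders VERBATIM + «ordinary if good at `3`» + `Ram W₀ 3` + `v₃(∏ c_ℓ) ≤ 1` +
`3 ∣ ∏ c_ℓ` + the two decidable guards «`p³ ∤ N` at every additive place with `3 ∣ #Φ_p(𝔽̄_p)`» (`f = 2`) and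
«`N > 3p²` at an additive `p` with `3 ∣ c_p`» (Diamond–Ribet's `N_Σ > 3p`), from TWELVE NAMED FACTS and NOTHING ELSE.
[cite: DarmonDiamondTaylor1995, Thm. 3.15, Lemma 2.7, Thm. 3.1 (e)] [cite: DiamondRibet1997, §4.5 Lemma 4.6]
[cite: Ribet1984ICM, Thm. 4.1] [cite: ColemanEdixhoven1998, Thm. 2.1] [cite: Vatsal1999, §1 (1.6), Thm. (1.13)]
[cite: GreenbergVatsal2000, §3 (17)–(19)] [cite: Skinner2016PacificMC, Thm. C (§1)] [cite: Mazur1978, Cor. 4.1]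
[cite: Kim2022StructureSelmer, Conj. 1.10 (PDF p. 8)] [cite: SilvermanATAEC1994, Cor. IV.9.2 (d), Table 4.1, §IV.10] -/
theorem stub_nonAdditive_ram_tamagawaDepthOne
    (hRk : ribet1990_levelLowering_gamma0_newform_at_three_additiveDrop)
    (hDR : diamondRibet1997_iharaLemma_at_dividingPrime_three_additive)
    (hCa : carayol1986_cuspCoeff_congr_at_additiveDrop_three)
    (hCE : colemanEdixhoven1998_heckePolynomial_simpleRoots)
    (hV : vatsal1999_plusSymbol_congruence) (hGV : greenbergVatsal2000_plusSymbol_congruence)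
    (hI : ribet1984_iharaLemma)
    (hSk : Skinner2016.thmC_padicValRat_bsd_rank_zero)
    (hmod : hasEntireLFunction_rat) (hGZK : rank_eq_analyticRank_of_analyticRank_le_one)
    (hM : mazur_not_dvd_maninConstant_of_odd) :
    ∀ (W₀ : WeierstrassCurve ℚ) [W₀.IsElliptic] [W₀.IsGloballyMinimal],
      (∀ n : ℕ, W₀.HasSurjectiveModNGaloisRep (3 ^ n : ℕ)) → Finite W₀.sha →
      ∀ {N : ℕ} [NeZero N], N = W₀.conductorNorm ℤ →
      ∀ (D₀ : ModularParametrizationData W₀ N),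
        (∀ z ∈ D₀.L.lattice, ∃ w ∈ periodLattice D₀.f, z = D₀.c * w) →
        (∀ (W₂ : WeierstrassCurve ℚ) [W₂.IsElliptic] (D₂ : ModularParametrizationData W₂ N),
          D₂.f = D₀.f → D₀.modularDegree ≤ D₂.modularDegree) →
        (∀ r : ℚ, ratPlusSymbol D₀.f r ≠ 0 → 0 ≤ padicValRat 3 (ratPlusSymbol D₀.f r)) →
        kuriharaVanishingOrder W₀ 3 D₀.f = 0 →
        ¬ (haveI : Fact (Nat.Prime 3) := ⟨Nat.prime_three⟩; Addv W₀ 3) →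
        (W₀.HasGoodReductionAtPrime 3 → ¬ (3 : ℤ) ∣ W₀.frobeniusTrace 3) →
        (haveI : Fact (Nat.Prime 3) := ⟨Nat.prime_three⟩; Ram W₀ 3) →
        padicValNat 3 W₀.tamagawaProduct ≤ 1 → 3 ∣ W₀.tamagawaProduct →
        (∀ v : HeightOneSpectrum ℤ, W₀.HasAdditiveReductionAt v → 3 ∣ (W₀.kodairaSymbolAt v).componentGroupOrder →
          ¬ natGenerator v ^ 3 ∣ N) →
        (∀ (p : ℕ) (hp : p.Prime), p ^ 2 ∣ N →
          3 ∣ (haveI := Fact.mk hp; (W₀.baseChange ℚ_[p]).localTamagawaNumber ℤ_[p]) → 3 * p ^ 2 < N) →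
        ∃ d : ℕ, kuriharaPartialDeepInfty W₀ 3 D₀.f = d ∧
          kuriharaPartial W₀ 3 D₀.f 0 ≤
            ((padicValNat 3 (Nat.card (AddCommGroup.primaryComponent W₀.sha 3)) + d : ℕ) : ℕ∞) := by
  intro W₀ _ _ htower hfin N _ hN D₀ hopt hdeg hint hord hnA hordinary hram hv h3 hK3 hbig
  by_cases hKc : ∀ (p : ℕ) (hp : p.Prime), p ^ 2 ∣ N →
      ¬ 3 ∣ (haveI := Fact.mk hp; (W₀.baseChange ℚ_[p]).localTamagawaNumber ℤ_[p])
  · exact stub_nonAdditive_ram_tamagawaDepthOne_of_drop hRk hCE hV hGV hI hSk hmod hGZK hM W₀ htower hfin hN D₀ hopt hdeg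
      hint hord hnA hordinary hram hv h3 hKc hK3
  · push Not at hKc
    obtain ⟨ℓ, hℓ, hℓ2N, h3c⟩ := hKc
    exact stub_nonAdditive_ram_tamagawaDepthOne_of_additiveTamagawa hRk hDR hCa hCE hV hGV hSk hmod hGZK hM W₀ htower hfin hN
      D₀ hopt hdeg hint hord hnA hordinary hram hv ℓ hℓ hℓ2N h3c (hbig ℓ hℓ hℓ2N h3c) hK3

/-- ★¹⁵ **`stub_nonAdditive` (crux 19679) on EVERY row of TAMAGAWA DEPTH `≤ 1` WITH (ram)** — stub binders VERBATIM +
«ordinary if good at `3`» + `Ram W₀ 3` + `v₃(∏ c_ℓ) ≤ 1` + the two decidable guards of ★¹⁴ (which only bite when the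
Tamagawa `3` sits at an additive place): if `3 ∤ ∏ c_ℓ` the lower half of BSD₃ alone (Skinner 2016 Thm. C BY NAME,
`…Sockets.missingLowerBoundAt_three_of_rowC1_of_skinner`, with Mazur's Manin transfer) gives the conclusion with `c = 0`
(`…SmallDefect.deepLower_conclusion_of_missingLowerBoundAt_of_not_dvd_tamagawa`); if `3 ∣ ∏ c_ℓ`, ★¹⁴. TWELVE named facts.
[cite: Skinner2016PacificMC, Thm. C (§1)] [cite: Mazur1978, Cor. 4.1] [cite: Kim2022StructureSelmer, Thm. 1.9 (6), Conj. 1.10]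
[cite: DarmonDiamondTaylor1995, Thm. 3.15, Thm. 3.1 (e)] [cite: DiamondRibet1997, §4.5 Lemma 4.6] [cite: Ribet1984ICM, Thm. 4.1] -/
theorem stub_nonAdditive_ram_tamagawaDepthLeOne
    (hRk : ribet1990_levelLowering_gamma0_newform_at_three_additiveDrop)
    (hDR : diamondRibet1997_iharaLemma_at_dividingPrime_three_additive)
    (hCa : carayol1986_cuspCoeff_congr_at_additiveDrop_three)
    (hCE : colemanEdixhoven1998_heckePolynomial_simpleRoots)
    (hV : vatsal1999_plusSymbol_congruence) (hGV : greenbergVatsal2000_plusSymbol_congruence)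
    (hI : ribet1984_iharaLemma)
    (hSk : Skinner2016.thmC_padicValRat_bsd_rank_zero)
    (hmod : hasEntireLFunction_rat) (hGZK : rank_eq_analyticRank_of_analyticRank_le_one)
    (hM : mazur_not_dvd_maninConstant_of_odd) :
    ∀ (W₀ : WeierstrassCurve ℚ) [W₀.IsElliptic] [W₀.IsGloballyMinimal],
      (∀ n : ℕ, W₀.HasSurjectiveModNGaloisRep (3 ^ n : ℕ)) → Finite W₀.sha →
      ∀ {N : ℕ} [NeZero N], N = W₀.conductorNorm ℤ →
      ∀ (D₀ : ModularParametrizationData W₀ N),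
        (∀ z ∈ D₀.L.lattice, ∃ w ∈ periodLattice D₀.f, z = D₀.c * w) →
        (∀ (W₂ : WeierstrassCurve ℚ) [W₂.IsElliptic] (D₂ : ModularParametrizationData W₂ N),
          D₂.f = D₀.f → D₀.modularDegree ≤ D₂.modularDegree) →
        (∀ r : ℚ, ratPlusSymbol D₀.f r ≠ 0 → 0 ≤ padicValRat 3 (ratPlusSymbol D₀.f r)) →
        kuriharaVanishingOrder W₀ 3 D₀.f = 0 →
        ¬ (haveI : Fact (Nat.Prime 3) := ⟨Nat.prime_three⟩; Addv W₀ 3) →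
        (W₀.HasGoodReductionAtPrime 3 → ¬ (3 : ℤ) ∣ W₀.frobeniusTrace 3) →
        (haveI : Fact (Nat.Prime 3) := ⟨Nat.prime_three⟩; Ram W₀ 3) →
        padicValNat 3 W₀.tamagawaProduct ≤ 1 →
        (∀ v : HeightOneSpectrum ℤ, W₀.HasAdditiveReductionAt v → 3 ∣ (W₀.kodairaSymbolAt v).componentGroupOrder →
          ¬ natGenerator v ^ 3 ∣ N) →
        (∀ (p : ℕ) (hp : p.Prime), p ^ 2 ∣ N →
          3 ∣ (haveI := Fact.mk hp; (W₀.baseChange ℚ_[p]).localTamagawaNumber ℤ_[p]) → 3 * p ^ 2 < N) →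
        ∃ d : ℕ, kuriharaPartialDeepInfty W₀ 3 D₀.f = d ∧
          kuriharaPartial W₀ 3 D₀.f 0 ≤
            ((padicValNat 3 (Nat.card (AddCommGroup.primaryComponent W₀.sha 3)) + d : ℕ) : ℕ∞) := by
  intro W₀ _ _ htower hfin N _ hN D₀ hopt hdeg hint hord hnA hordinary hram hv hK3 hbig
  by_cases h3 : 3 ∣ W₀.tamagawaProduct
  · exact stub_nonAdditive_ram_tamagawaDepthOne hRk hDR hCa hCE hV hGV hI hSk hmod hGZK hM W₀ htower hfin hN D₀ hopt hdeg hint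
      hord hnA hordinary hram hv h3 hK3 hbig
  · haveI : Fact (Nat.Prime 3) := ⟨Nat.prime_three⟩
    have hf : IsNewformOf W₀ D₀.f := D₀.isNewformOf
    have hr0 : W₀.analyticRank = 0 := analyticRank_eq_zero_of_kuriharaVanishingOrder_eq_zero W₀ D₀.f hf hord
    have hirr : W₀.HasIrreducibleModPGaloisRep 3 :=
      hasIrreducibleModPGaloisRep_of_hasSurjectiveModNGaloisRep W₀ 3 (by simpa using htower 1)
    have hper := periodTransfer_three_of_optimal_of_not_addv W₀ hM hN D₀ hopt hnA
    have hred : (W₀.HasGoodReductionAtPrime 3 ∧ ¬ (3 : ℤ) ∣ W₀.frobeniusTrace 3) ∨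
        W₀.HasMultiplicativeReductionAtPrime 3 := by
      by_cases hgood : W₀.HasGoodReductionAtPrime 3
      · exact Or.inl ⟨hgood, hordinary hgood⟩
      · right
        by_contra hm
        exact hnA ⟨hgood, hm⟩
    have hlow : MissingLowerBoundAt W₀ 3 :=
      missingLowerBoundAt_three_of_rowC1_of_skinner W₀ hSk hmod hGZK hr0 hirr hred hram
    exact deepLower_conclusion_of_missingLowerBoundAt_of_not_dvd_tamagawa W₀ 3 D₀.f hGZK (by norm_num) hirr hf hord hper
      hlow h3

end ClassAll

end Summit.BirchSwinnertonDyer.BirchSwinnertonDyer.Theorems.KimAtThreeDeepLowerOffStratumLevelLoweringDepleteTamagawaRowsClass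

end
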